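import Summits.ValiantsHypothesis.ValiantsHypothesis.Theorems.MonotoneRestorationOrbitRestorationQPTermBlocksTransport
import Summits.ValiantsHypothesis.ValiantsHypothesis.Theorems.MonotoneRestorationOrbitRestorationQPSupportBlocks
import HarnessLib

/-!
# Value-permuted term systems with untwisted TERM-RELATIVE support blocks restore (kind (P) made intrinsic)

Route MonotoneRestoration, crux `OrbitRestorationQP` (stmt-ValiantsHypothesis-18293), line `depth-three-rung`, rung
`A_∞ = stub_sigmaPiSigmaValue`; namespace `Summit.ValiantsHypothesis.ValiantsHypothesis.Theorems.TermBlocks`.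

The support-block theorem (`SupportBlocks.qpOrbitRestorable_of_untwisted_supportBlocks`, XVII) restores ONE diagonally
invariant affine product whose support blocks are untwisted.  Here is its version for MANY-TERM representations
`p = Σ_t a_t · Π L_t` whose terms are permuted AS VALUES (`σ · (a_t Π L_t) = a_{σ•t} Π L_{σ•t}`; `t` ranging over a
finite `Sym(Fin n)`-set with equivariant keys `key t` whose pointwise stabiliser fixes `t`), with supported factors
(`supp`, unit-invariant and equivariant as in XVII).  The factors of the term `t` are grouped by their support RELATIVE TO
THE KEY, `R = supp ℓ ∖ key t` — in `e₂` of the column Vandermondes (`…TermBlocksPairedVandermondes.lean`) the key of the term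
`D_j D_{j'}` is `{j, j'}` and the relative support of `x_{ij} − x_{i'j}` is the row pair `{i, i'}`, so the relative blocks
are exactly the PAIRS `{x_{ij} − x_{i'j}, x_{ij'} − x_{i'j'}}`, while the absolute support blocks `{x_{ij} − x_{i'j}}` are
twisted.  HYPOTHESIS (TBʳ, untwisted relative blocks): every `ρ` fixing the term `t` and the class `R` fixes the block
product `Π {ℓ ∈ L_t : supp ℓ ∖ key t = R}`.  CONCLUSION (`qpOrbitRestorable_of_untwisted_relSupportBlocks`): `p` is
`QPOrbitRestorable (2k + 5)`.  Proof: unique factorisation transports relative blocks up to units along the term system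
(`exists_unit_relBlock`: the factor multisets of `σ · L_t` and `L_{σ•t}` have the same associates because the terms are
permuted as values), blocks along an orbit have the same size (`card_relBlock_smul`), and the stabiliser form of the
term-block criterion (`qpOrbitRestorable_of_termBlocks_stab`, `…TermBlocksTransport.lean`) does the rest.

Honest label: positive-lane structural theorem (the intrinsic form of kind (P) for sign/phase twists killed by the
relative blocking); the KEYED refinement (characters that survive on relative blocks, as in `KeyedBlocks` XXI for one
product) and the full value-permuted case (relative A₁) remain open.  The stub, the crux and VP ≠ VNP are not moved.
Everything is proved. [folklore]

## References
* A. Dawar, G. Wilsenach, *Symmetric arithmetic circuits*, ToC 21 (2025), §3.3, Def. 6.1. [DawarWilsenach2025]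
-/

noncomputable section

open scoped Classical Pointwise

-- `Summit.ValiantsHypothesis.ValiantsHypothesis.…` is the tree's single-conjunct layout (Sub = Summit).
set_option linter.dupNamespace false

namespace Summit.ValiantsHypothesis.ValiantsHypothesis.Theorems

namespace TermBlocks

open Equiv Finset Literature.Computability.AlgebraicComplexity OrbitRestorationQPDepthThreeRung SupportBlocks

variable {n : ℕ}

/-- **Value-permuted terms have factor multisets with the same associates**: if
`σ · (a_t Π L_t) = a_{σ•t} Π L_{σ•t}` with `a_t ≠ 0` and degree-one factors, then `σ · L_t` and `L_{σ•t}` agree up to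
units, factor by factor (unique factorisation). [folklore] -/
theorem map_mk_map_ren_eq_of_terms {T : Type} [MulAction (Perm (Fin n)) T] (a : T → ℂ)
    (L : T → Multiset (MvPolynomial (Fin n × Fin n) ℂ)) (hL1 : ∀ t, ∀ ℓ ∈ L t, ℓ.totalDegree = 1)
    (ha0 : ∀ t, a t ≠ 0)
    (hF : ∀ (σ : Perm (Fin n)) (t : T), ren σ (MvPolynomial.C (a t) * (L t).prod) =
      MvPolynomial.C (a (σ • t)) * (L (σ • t)).prod)
    (σ : Perm (Fin n)) (t : T) : ((L t).map (ren σ)).map Associates.mk = (L (σ • t)).map Associates.mk := by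
  have hirr : ∀ x ∈ (L t).map (ren σ), Irreducible x := by
    intro x hx
    obtain ⟨ℓ, hℓ, rfl⟩ := Multiset.mem_map.1 hx
    exact AffineFactors.irreducible_of_totalDegree_eq_one (by rw [AffineFactors.totalDegree_ren, hL1 t ℓ hℓ])
  have hirr' : ∀ x ∈ L (σ • t), Irreducible x := fun x hx =>
    AffineFactors.irreducible_of_totalDegree_eq_one (hL1 _ x hx)
  have h := hF σ t
  rw [map_mul, ren_C, map_multiset_prod] at h
  -- `Π (σ L_t) = (a_t⁻¹ a_{σt}) · Π L_{σt}`
  have hprod : ((L t).map (ren σ)).prod =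
      MvPolynomial.C ((a t)⁻¹ * a (σ • t)) * (L (σ • t)).prod := by
    have := congrArg (fun q => MvPolynomial.C (a t)⁻¹ * q) h
    simp only [← mul_assoc, ← map_mul, inv_mul_cancel₀ (ha0 t), map_one, one_mul] at this
    exact this
  have hassoc : Associated ((L t).map (ren σ)).prod (L (σ • t)).prod := by
    rw [hprod]
    exact associated_unit_mul_left _ _ (IsUnit.map MvPolynomial.C
      (isUnit_iff_ne_zero.2 (mul_ne_zero (inv_ne_zero (ha0 t)) (ha0 _))))
  exact Associates.rel_associated_iff_map_eq_map.1 (UniqueFactorizationMonoid.factors_unique hirr hirr' hassoc)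

/-- **Relative support blocks are transported up to units along a value-permuted term system.** [folklore] -/
theorem exists_unit_relBlock {T : Type} [MulAction (Perm (Fin n)) T] (a : T → ℂ)
    (L : T → Multiset (MvPolynomial (Fin n × Fin n) ℂ)) (key : T → Finset (Fin n))
    (supp : MvPolynomial (Fin n × Fin n) ℂ → Finset (Fin n))
    (S1 : ∀ (q : MvPolynomial (Fin n × Fin n) ℂ) (u : ℂ), u ≠ 0 → supp (MvPolynomial.C u * q) = supp q)
    (S2 : ∀ (q : MvPolynomial (Fin n × Fin n) ℂ) (σ : Perm (Fin n)), supp (ren σ q) = σ • supp q)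
    (hkey : ∀ (σ : Perm (Fin n)) (t : T), key (σ • t) = σ • key t)
    (hL1 : ∀ t, ∀ ℓ ∈ L t, ℓ.totalDegree = 1) (ha0 : ∀ t, a t ≠ 0)
    (hF : ∀ (σ : Perm (Fin n)) (t : T), ren σ (MvPolynomial.C (a t) * (L t).prod) =
      MvPolynomial.C (a (σ • t)) * (L (σ • t)).prod)
    (σ : Perm (Fin n)) (t : T) (R : Finset (Fin n)) :
    ∃ c : ℂ, c ≠ 0 ∧ ren σ ((L t).filter fun ℓ => supp ℓ \ key t = R).prod =
      MvPolynomial.C c * ((L (σ • t)).filter fun ℓ => supp ℓ \ key (σ • t) = σ • R).prod := by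
  have hP : ∀ p q : MvPolynomial (Fin n × Fin n) ℂ, Associated p q →
      (supp p \ key (σ • t) = σ • R ↔ supp q \ key (σ • t) = σ • R) := by
    intro p q hpq
    obtain ⟨c, hc0, rfl⟩ := exists_C_of_associated hpq
    rw [S1 p c hc0]
  have h1 := map_mk_filter_eq hP (map_mk_map_ren_eq_of_terms a L hL1 ha0 hF σ t)
  have h2 : ((L t).map (ren σ)).filter (fun ℓ => supp ℓ \ key (σ • t) = σ • R) =
      ((L t).filter fun ℓ => supp ℓ \ key t = R).map (ren σ) := by
    rw [Multiset.filter_map]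
    congr 1
    refine Multiset.filter_congr fun ℓ _ => ?_
    simp only [Function.comp_apply, S2, hkey, ← Finset.smul_finset_sdiff]
    constructor
    · intro h; simpa using congrArg (fun S => σ⁻¹ • S) h
    · intro h; rw [h]
  rw [h2] at h1
  have h3 := congrArg Multiset.prod h1
  rw [Associates.prod_mk, Associates.prod_mk, Associates.mk_eq_mk_iff_associated, ← map_multiset_prod] at h3
  obtain ⟨c, hc0, hc⟩ := exists_C_of_associated h3.symm
  exact ⟨c, hc0, hc⟩

/-- **Relative blocks along an orbit have the same size.** [folklore] -/
theorem card_relBlock_smul {T : Type} [MulAction (Perm (Fin n)) T] (a : T → ℂ)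
    (L : T → Multiset (MvPolynomial (Fin n × Fin n) ℂ)) (key : T → Finset (Fin n))
    (supp : MvPolynomial (Fin n × Fin n) ℂ → Finset (Fin n))
    (S1 : ∀ (q : MvPolynomial (Fin n × Fin n) ℂ) (u : ℂ), u ≠ 0 → supp (MvPolynomial.C u * q) = supp q)
    (S2 : ∀ (q : MvPolynomial (Fin n × Fin n) ℂ) (σ : Perm (Fin n)), supp (ren σ q) = σ • supp q)
    (hkey : ∀ (σ : Perm (Fin n)) (t : T), key (σ • t) = σ • key t)
    (hL1 : ∀ t, ∀ ℓ ∈ L t, ℓ.totalDegree = 1) (ha0 : ∀ t, a t ≠ 0)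
    (hF : ∀ (σ : Perm (Fin n)) (t : T), ren σ (MvPolynomial.C (a t) * (L t).prod) =
      MvPolynomial.C (a (σ • t)) * (L (σ • t)).prod)
    (σ : Perm (Fin n)) (t : T) (R : Finset (Fin n)) :
    Multiset.card ((L (σ • t)).filter fun ℓ => supp ℓ \ key (σ • t) = σ • R) =
      Multiset.card ((L t).filter fun ℓ => supp ℓ \ key t = R) := by
  have hP : ∀ p q : MvPolynomial (Fin n × Fin n) ℂ, Associated p q →
      (supp p \ key (σ • t) = σ • R ↔ supp q \ key (σ • t) = σ • R) := by
    intro p q hpq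
    obtain ⟨c, hc0, rfl⟩ := exists_C_of_associated hpq
    rw [S1 p c hc0]
  have h1 := map_mk_filter_eq hP (map_mk_map_ren_eq_of_terms a L hL1 ha0 hF σ t)
  have h2 : ((L t).map (ren σ)).filter (fun ℓ => supp ℓ \ key (σ • t) = σ • R) =
      ((L t).filter fun ℓ => supp ℓ \ key t = R).map (ren σ) := by
    rw [Multiset.filter_map]
    congr 1
    refine Multiset.filter_congr fun ℓ _ => ?_
    simp only [Function.comp_apply, S2, hkey, ← Finset.smul_finset_sdiff]
    constructor
    · intro h; simpa using congrArg (fun S => σ⁻¹ • S) h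
    · intro h; rw [h]
  rw [h2] at h1
  have h3 := congrArg Multiset.card h1
  simp only [Multiset.card_map] at h3
  exact h3.symm

/-- **VALUE-PERMUTED TERM SYSTEMS WITH UNTWISTED TERM-RELATIVE SUPPORT BLOCKS ARE ORBIT-RESTORABLE.**  Let `t` range
over a finite `Sym(Fin n)`-set with equivariant keys `key t` (`≤ k` indices whose pointwise stabiliser fixes `t`),
`p = Σ_t a_t · Π L_t` with `a_t ≠ 0`, degree-one factors carrying unit-invariant equivariant supports of `≤ k` indices
whose pointwise stabilisers fix them, and the terms permuted as values.  If (TBʳ) every permutation fixing `t` and the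
class `R` fixes the relative block `Π {ℓ ∈ L_t : supp ℓ ∖ key t = R}`, then `p` is `QPOrbitRestorable (2k + 5)` at
level `n`. [folklore; cite: DawarWilsenach2025, §3.3 and Def. 6.1] -/
theorem qpOrbitRestorable_of_untwisted_relSupportBlocks {k : ℕ} {T : Type} [Fintype T]
    [MulAction (Perm (Fin n)) T] (a : T → ℂ) (L : T → Multiset (MvPolynomial (Fin n × Fin n) ℂ))
    (key : T → Finset (Fin n)) (supp : MvPolynomial (Fin n × Fin n) ℂ → Finset (Fin n))
    (S1 : ∀ (q : MvPolynomial (Fin n × Fin n) ℂ) (u : ℂ), u ≠ 0 → supp (MvPolynomial.C u * q) = supp q)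
    (S2 : ∀ (q : MvPolynomial (Fin n × Fin n) ℂ) (σ : Perm (Fin n)), supp (ren σ q) = σ • supp q)
    (S3 : ∀ t, ∀ ℓ ∈ L t, ∀ τ : Perm (Fin n), (∀ x ∈ supp ℓ, τ x = x) → ren τ ℓ = ℓ)
    (S4 : ∀ t, ∀ ℓ ∈ L t, (supp ℓ).card ≤ k)
    (hkey : ∀ (σ : Perm (Fin n)) (t : T), key (σ • t) = σ • key t) (hkeyk : ∀ t, (key t).card ≤ k)
    (hTfix : ∀ (t : T) (σ : Perm (Fin n)), (∀ x ∈ key t, σ x = x) → σ • t = t)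
    (hL1 : ∀ t, ∀ ℓ ∈ L t, ℓ.totalDegree = 1) (ha0 : ∀ t, a t ≠ 0)
    (hF : ∀ (σ : Perm (Fin n)) (t : T), ren σ (MvPolynomial.C (a t) * (L t).prod) =
      MvPolynomial.C (a (σ • t)) * (L (σ • t)).prod)
    (hTB : ∀ (ρ : Perm (Fin n)) (t : T) (R : Finset (Fin n)), ρ • t = t → ρ • R = R →
      ren ρ ((L t).filter fun ℓ => supp ℓ \ key t = R).prod = ((L t).filter fun ℓ => supp ℓ \ key t = R).prod) :
    QPOrbitRestorable (2 * k + 5) n (∑ t, MvPolynomial.C (a t) * (L t).prod) := by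
  -- the relative blocks, indexed by pairs (term, class)
  set M : T × Finset (Fin n) → Multiset (MvPolynomial (Fin n × Fin n) ℂ) :=
    fun b => (L b.1).filter fun ℓ => supp ℓ \ key b.1 = b.2 with hM
  -- the term of the block system is the term of `p`
  have hterm : ∀ t : T, ∏ b ∈ univ.filter (fun b : T × Finset (Fin n) => b.1 = t), (M b).prod = (L t).prod := by
    intro t
    rw [prod_filter, Fintype.prod_prod_type_right]
    simp only [prod_ite_eq', mem_univ, if_true, hM]
    exact prod_filter_eq_prod (fun ℓ => supp ℓ \ key t) (L t)
  have hsum : (∑ t, MvPolynomial.C (a t) * (L t).prod) =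
      ∑ t, MvPolynomial.C (a t) * ∏ b ∈ univ.filter (fun b : T × Finset (Fin n) => b.1 = t), (M b).prod := by
    simp only [hterm]
  rw [hsum]
  refine qpOrbitRestorable_of_termBlocks_stab (k := 2 * k) Prod.fst (fun σ b => rfl) M a
    (fun b q hq => hL1 b.1 q (Multiset.mem_filter.1 hq).1) (fun b q hq => ?_) (fun b => ?_) (fun σ b => ?_)
    (fun σ b => ?_) (fun ρ b hb => ?_) (fun t _ => ⟨key t, (hkeyk t).trans (by omega), hTfix t⟩) (fun σ t => ?_)
  · -- supported forms
    obtain ⟨hqL, -⟩ := Multiset.mem_filter.1 hq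
    exact ⟨supp q, (S4 b.1 q hqL).trans (by omega), S3 b.1 q hqL⟩
  · -- exactly permuted by the pointwise stabiliser of `key t ∪ R`
    by_cases h0 : M b = 0
    · exact ⟨∅, by simp, fun τ _ => by rw [h0, Multiset.map_zero]⟩
    · obtain ⟨ℓ, hℓ⟩ := Multiset.exists_mem_of_ne_zero h0
      obtain ⟨hℓL, hℓR⟩ := Multiset.mem_filter.1 hℓ
      refine ⟨key b.1 ∪ b.2, ?_, fun τ hτ => ?_⟩
      · calc (key b.1 ∪ b.2).card ≤ (key b.1).card + b.2.card := card_union_le _ _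
          _ ≤ k + k := Nat.add_le_add (hkeyk b.1)
              (by rw [← hℓR]; exact (card_le_card Finset.sdiff_subset).trans (S4 b.1 ℓ hℓL))
          _ = 2 * k := by ring
      · have hfix : ∀ q ∈ M b, ren τ q = q := by
          intro q hq
          obtain ⟨hqL, hqR⟩ := Multiset.mem_filter.1 hq
          refine S3 b.1 q hqL τ fun x hx => hτ x ?_
          rw [mem_union]
          by_cases hxk : x ∈ key b.1
          · exact Or.inl hxk
          · right; rw [← hqR]; exact mem_sdiff.2 ⟨hx, hxk⟩
        conv_rhs => rw [← Multiset.map_id (M b)]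
        exact Multiset.map_congr rfl fun q hq => by rw [hfix q hq, id]
  · -- blocks along an orbit have the same size
    show Multiset.card ((L (σ • b).1).filter fun ℓ => supp ℓ \ key (σ • b).1 = (σ • b).2) =
      Multiset.card ((L b.1).filter fun ℓ => supp ℓ \ key b.1 = b.2)
    exact card_relBlock_smul a L key supp S1 S2 hkey hL1 ha0 hF σ b.1 b.2
  · -- projective equivariance of the relative blocks
    exact exists_unit_relBlock a L key supp S1 S2 hkey hL1 ha0 hF σ b.1 b.2
  · -- untwisted stabilisers
    have h1 : ρ • b.1 = b.1 := congrArg Prod.fst hb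
    have h2 : ρ • b.2 = b.2 := congrArg Prod.snd hb
    exact hTB ρ b.1 b.2 h1 h2
  · -- the terms are permuted as values
    rw [hterm, hterm]; exact hF σ t

end TermBlocks

end Summit.ValiantsHypothesis.ValiantsHypothesis.Theorems

end
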